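import Summits.ResolutionOfSingularities.ResolutionOfSingularities.Theorems.FrobeniusLadderFInjectiveMacaulayficationFCUnguardedAprime
import Summits.ResolutionOfSingularities.ResolutionOfSingularities.Theorems.FrobeniusLadderFInjectiveMacaulayficationLocFixFullAtNonClosedLowDim
import HarnessLib

/-!
# (T1″) `LocFixFullAtNonClosed` HOLDS modulo the named facts — the by-name closer of door v31's would-be stub `stub_locFixFullAtNonClosed`
# (crux `FInjectiveMacaulayfication` stmt-ResolutionOfSingularities-15315, chain w45a; res-L1-w45a-plan-1 R16.13 (1b) / R16.16; seat
# res-L1-w45a-stub-1 g6)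

[OURS · L1 W4.5a] Support file (`--supports stmt-ResolutionOfSingularities-15315 --as helper`); NOT a statement of any manuscript;
AI-written (AI review is weaker than expert review). One line: the typed target `FCUnguardedAprime.LocFixFullAtNonClosed` (FC2Dim4Sig v0.7
(T1″), res-L1-w45a-stub-3) IS the kernel theorem `LocFixFullAtNonClosedLowDim.locFixFull_atNonClosed_lowDim` (its binders were typed
verbatim, `LocFixDataFull` unfolded). Named facts enter BY NAME as hypotheses: Lipman 1978, Cossart–Piltant 2019 (General,
Principalization), Stacks 081R, Datta–Murayama 2024 Thm. B, `CMLocusOpen`. [folklore assembly]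
-/

-- single-problem summit: the doubled namespace component is forced
set_option linter.dupNamespace false

noncomputable section

namespace Summit.ResolutionOfSingularities.ResolutionOfSingularities.Theorems.FInjectiveMacaulayfication.FCUnguardedAprime

open Summit.ResolutionOfSingularities.ResolutionOfSingularities.Theorems.FInjectiveMacaulayfication

/-- **(T1″) HOLDS modulo the named facts**: the FULL (A′) datum at every non-closed bad point of local dimension 2 or 3 — by
`LocFixFullAtNonClosedLowDim.locFixFull_atNonClosed_lowDim`. [folklore assembly; cite: Lipman1978; CossartPiltant2019, Thm. 1.1;
DattaMurayama2024, Thm. B; StacksProject, Tag 0804] -/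
theorem locFixFullAtNonClosed_of_facts
    (hL : Literature.AlgebraicGeometry.Resolution.Lipman1978SequenceFinite.{0})
    (hG : Literature.AlgebraicGeometry.Resolution.CossartPiltant2019General.{0})
    (h081R : Literature.AlgebraicGeometry.Resolution.Stacks081R.{0})
    (hP : Literature.AlgebraicGeometry.Resolution.CossartPiltant2019Principalization.{0})
    (hDM : Literature.AlgebraicGeometry.Resolution.DattaMurayama2024_fInjectiveLocusOpen.{0})
    (hCMo : NonFullLocusClosed.CMLocusOpen) : LocFixFullAtNonClosed :=
  fun p hp k _ _ X₁ f₁ hs hft hqc hi h4 hCM η hη hbad h2 h3 hgen =>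
    LocFixFullAtNonClosedLowDim.locFixFull_atNonClosed_lowDim hL hG h081R hP hDM hCMo p hp k X₁ f₁ hs hft hqc hi h4 hCM η hη hbad
      h2 h3 hgen

/-- With (T1″) discharged, the (A′) assembly needs only (T2′) and (T3′): `FCUnguardedLowDim ⟸ SpreadGoodAprime + RelClosedSubsetFix`
modulo the named facts. [plumbing] -/
theorem fcUnguardedLowDim_of_facts
    (hL : Literature.AlgebraicGeometry.Resolution.Lipman1978SequenceFinite.{0})
    (hG : Literature.AlgebraicGeometry.Resolution.CossartPiltant2019General.{0})
    (h081R : Literature.AlgebraicGeometry.Resolution.Stacks081R.{0})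
    (hP : Literature.AlgebraicGeometry.Resolution.CossartPiltant2019Principalization.{0})
    (hDM : Literature.AlgebraicGeometry.Resolution.DattaMurayama2024_fInjectiveLocusOpen.{0})
    (hCMo : NonFullLocusClosed.CMLocusOpen) (h₂ : SpreadGoodAprime) (h₃ : RelClosedSubsetFix) : FCUnguardedLowDim :=
  fcUnguardedLowDim_of_aprime (locFixFullAtNonClosed_of_facts hL hG h081R hP hDM hCMo) h₂ h₃

end Summit.ResolutionOfSingularities.ResolutionOfSingularities.Theorems.FInjectiveMacaulayfication.FCUnguardedAprime

end
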